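import Mathlib
import Literature.Probability.LatticeModels.ThermodynamicLimit
import Literature.Probability.LatticeModels.SharpnessProofs
import Summits.CriticalPhenomena.Ising3DConformalLimit.Theorems.PrecisionLaplacianDirectCorrelationStableTailKernelScalingAux6
import Summits.CriticalPhenomena.Ising3DConformalLimit.Theorems.PrecisionLaplacianDirectCorrelationStableTailKernelScalingAux7
import HarnessLib

/-!
# Stub `stub_kernelScaling` of line `diffusive-branch-is-nonsaturation`
(crux `PrecisionLaplacian.DirectCorrelationStableTail`, item stmt-CriticalPhenomena-4799)

**The kernel side at scale under the isotropic pure power law.**  Let `G : ℤ³ → [0,1]` be even with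
`G(x)|x|₂^{3-α} → c > 0` cofinitely, `1 < α < 2`, and let `φ(v) = e^{-t|v|₂²} cos(k·v)` (`t > 0`).
Then `z ↦ φ(z/R)` is summable over `ℤ³` (`R ≥ 1`) and, uniformly in `y ∈ ℤ³`,
`R^{-α}(Ψ_R(0) − Ψ_R(y)) = c·D(y/R) + o(1)·min(|y/R|₂², 1)` as `R → ∞`, where
`Ψ_R(y) = Σ_z φ(z/R) G(z − y)` and `D(u) = ∫ |v|₂^{α-3}(φ(v) − φ(v+u)) dv`.

Proof (folklore).  Re-indexing, `Ψ_R(0) − Ψ_R(y) = Σₓ G(x)(φ(x/R) − φ(x/R + u))`, `u = y/R`.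
* `|u|₂ > 1`: apply the uniform Riemann lemma (`stub_kernelScaling_auxRiemann`) to `h = φ` with the
  shifts `s = 0` and `s = u` (Lipschitz bound `kernSc_phi_lipschitz`), error `≤ ε = ε·min(|u|₂²,1)`.
* `0 < |u|₂ ≤ 1`: by evenness of `G` and `φ` both sides symmetrise,
  `Ψ_R(0) − Ψ_R(y) = ½ Σₓ G(x) Δ²_u φ(x/R)` and `D(u) = ½ ∫ |v|₂^{α-3} Δ²_u φ`,
  `Δ²_u φ(w) = 2φ(w) − φ(w+u) − φ(w−u)`; apply the Riemann lemma to `h = Δ²_u φ/|u|₂²`, whose Gaussian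
  envelope and Lipschitz constant at scale `1/R` are uniform in `u` (`kernSc_secondDiff_env`,
  `kernSc_secondDiff_lipschitz`), error `≤ ½ ε |u|₂²`.
* `u = 0`: both sides vanish.
-/

noncomputable section

namespace Summit.CriticalPhenomena.Ising3DConformalLimit.Cruxes.DirectCorrelationStableTail.DiffusiveBranchIsNonsaturation

open MeasureTheory Filter Topology
open scoped BigOperators
open Literature.Probability.LatticeModels
open Summit.CriticalPhenomena.Ising3DConformalLimit.Cruxes.DirectCorrelationStableTail.SelfEnergyPickInversion

/-! ### The test function `φ(v) = e^{-t|v|₂²} cos(k·v)` -/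

/-- Continuity, Gaussian envelope `|φ| ≤ e^{-t|·|₂²}` and evenness of `φ`. [folklore] -/
theorem kernSc_phi_props {t : ℝ} {k : Fin 3 → ℝ} {φ : (Fin 3 → ℝ) → ℝ}
    (hφ : ∀ v, φ v = Real.exp (-(t * ∑ i, v i ^ 2)) * Real.cos (∑ i, k i * v i)) :
    Continuous φ ∧ (∀ v, |φ v| ≤ 1 * Real.exp (-(t * ∑ i, v i ^ 2))) ∧ (∀ v, φ (-v) = φ v) := by
  have hφ' : φ = fun v => Real.exp (-(t * ∑ i, v i ^ 2)) * Real.cos (∑ i, k i * v i) := funext hφ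
  refine ⟨by rw [hφ']; fun_prop, fun v => ?_, fun v => ?_⟩
  · rw [hφ, abs_mul, Real.abs_exp, one_mul]
    exact mul_le_of_le_one_right (Real.exp_pos _).le (Real.abs_cos_le_one _)
  · rw [hφ, hφ]
    simp [mul_neg, Finset.sum_neg_distrib, Real.cos_neg]

/-! ### Re-indexing the smeared kernel -/

/-- Shifted summability: if `f` is summable on `ℤ³` and `0 ≤ G ≤ 1` then `x ↦ G(x) f(x + y)` is
summable. [folklore] -/
theorem kernSc_summable_shift {f G : Site 3 → ℝ} (hf : Summable f) (hG0 : ∀ x, 0 ≤ G x)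
    (hG1 : ∀ x, G x ≤ 1) (y : Site 3) : Summable (fun x : Site 3 => G x * f (x + y)) := by
  have h1 : Summable (fun x : Site 3 => f (x + y)) := hf.comp_injective (add_left_injective y)
  refine Summable.of_norm_bounded h1.abs fun x => ?_
  rw [Real.norm_eq_abs, abs_mul, abs_of_nonneg (hG0 x)]
  exact (mul_le_mul_of_nonneg_right (hG1 x) (abs_nonneg _)).trans (by rw [one_mul])

/-- Re-indexing `z = x + y`: `Σ_z f(z) G(z − y) = Σₓ G(x) f(x + y)`. [folklore] -/
theorem kernSc_tsum_shift (f G : Site 3 → ℝ) (y : Site 3) :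
    ∑' z : Site 3, f z * G (z - y) = ∑' x : Site 3, G x * f (x + y) := by
  rw [← (Equiv.addRight y).tsum_eq (fun z => f z * G (z - y))]
  refine tsum_congr fun x => ?_
  simp only [Equiv.coe_addRight, add_sub_cancel_right]
  ring

/-- Re-indexing `x ↦ −x` for even `f`, `G`: `Σₓ G(x) f(x + y) = Σₓ G(x) f(x − y)`. [folklore] -/
theorem kernSc_tsum_reflect {f G : Site 3 → ℝ} (hf : ∀ x, f (-x) = f x) (hG : ∀ x, G (-x) = G x)
    (y : Site 3) : ∑' x : Site 3, G x * f (x + y) = ∑' x : Site 3, G x * f (x - y) := by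
  rw [← (Equiv.neg (Site 3)).tsum_eq (fun x => G x * f (x + y))]
  refine tsum_congr fun x => ?_
  simp only [Equiv.neg_apply, hG]
  rw [← hf, neg_add, neg_neg, sub_eq_add_neg]

/-! ### Symmetrising the integral `D(u)` -/

/-- For even `φ`: `∫ |v|₂^β (φ(v) − φ(v+u)) dv = ∫ |v|₂^β (φ(v) − φ(v−u)) dv` (substitute `v ↦ −v`).
[folklore] -/
theorem kernSc_integral_reflect {φ : (Fin 3 → ℝ) → ℝ} (hφe : ∀ v, φ (-v) = φ v) (β : ℝ)
    (u : Fin 3 → ℝ) :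
    ∫ v : Fin 3 → ℝ, √(∑ i, v i ^ 2) ^ β * (φ v - φ (v + u)) =
      ∫ v : Fin 3 → ℝ, √(∑ i, v i ^ 2) ^ β * (φ v - φ (v - u)) := by
  rw [← integral_neg_eq_self (fun v : Fin 3 → ℝ => √(∑ i, v i ^ 2) ^ β * (φ v - φ (v - u))) volume]
  refine integral_congr_ae (ae_of_all _ fun v => ?_)
  simp only [Pi.neg_apply, neg_sq, hφe]
  rw [show -v - u = -(v + u) by abel, hφe]

/-! ### Rescaled lattice points -/

/-- `(x + y)/R = x/R + y/R` coordinatewise for lattice points. [folklore] -/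
theorem kernSc_cast_add_div (x y : Site 3) (R : ℝ) :
    (fun i => (((x + y) i : ℤ) : ℝ) / R) = (fun i => (x i : ℝ) / R) + fun i => (y i : ℝ) / R := by
  funext i
  simp only [Pi.add_apply, Int.cast_add, add_div]

/-- `(x − y)/R = x/R − y/R` coordinatewise for lattice points. [folklore] -/
theorem kernSc_cast_sub_div (x y : Site 3) (R : ℝ) :
    (fun i => (((x - y) i : ℤ) : ℝ) / R) = (fun i => (x i : ℝ) / R) - fun i => (y i : ℝ) / R := by
  funext i
  simp only [Pi.sub_apply, Int.cast_sub, sub_div]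

/-- `(-x)/R = -(x/R)` coordinatewise for lattice points. [folklore] -/
theorem kernSc_cast_neg_div (x : Site 3) (R : ℝ) :
    (fun i => (((-x) i : ℤ) : ℝ) / R) = -fun i => (x i : ℝ) / R := by
  funext i
  simp only [Pi.neg_apply, Int.cast_neg, neg_div]

/-! ### The stub -/

/-- **Registered stub `stub_kernelScaling`** (line `diffusive-branch-is-nonsaturation`, crux
stmt-CriticalPhenomena-4799): the kernel side at scale.  For `0 ≤ G ≤ 1` even with
`G(x)|x|₂^{3-α} → c > 0` cofinitely, `1 < α < 2`, `t > 0`, `k ∈ ℝ³`, `φ(v) = e^{-t|v|₂²}cos(k·v)`: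
`z ↦ φ(z/R)` is summable (`R ≥ 1`) and, uniformly in `y ∈ ℤ³`,
`|R^{-α}(Ψ_R(0) − Ψ_R(y)) − c·D(y/R)| ≤ ε·min(|y/R|₂², 1)` for `R ≥ R₀(ε)`, where
`Ψ_R(y) = Σ_z φ(z/R) G(z − y)` and `D(u) = ∫ |v|₂^{α-3}(φ(v) − φ(v+u)) dv`. [folklore] -/
theorem stub_kernelScaling :
    ∀ (G : Site 3 → ℝ) (α c t : ℝ) (k : Fin 3 → ℝ),
      (∀ x, 0 ≤ G x) → (∀ x, G x ≤ 1) → (∀ x, G (-x) = G x) → 1 < α → α < 2 → 0 < c → 0 < t →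
      Filter.Tendsto (fun x : Site 3 => G x * Real.sqrt (∑ i, ((x i : ℝ)) ^ 2) ^ (3 - α)) Filter.cofinite (nhds c) →
      (∀ R : ℕ, 1 ≤ R → Summable (fun z : Site 3 =>
        Real.exp (-(t * ∑ i, ((z i : ℝ) / R) ^ 2)) * Real.cos (∑ i, k i * ((z i : ℝ) / R)))) ∧
      ∀ ε : ℝ, 0 < ε → ∃ R₀ : ℕ, ∀ R : ℕ, R₀ ≤ R → ∀ (Ψ : Site 3 → ℝ) (D : (Fin 3 → ℝ) → ℝ),
        (∀ y, Ψ y = ∑' z : Site 3,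
          (Real.exp (-(t * ∑ i, ((z i : ℝ) / R) ^ 2)) * Real.cos (∑ i, k i * ((z i : ℝ) / R))) * G (z - y)) →
        (∀ u, D u = ∫ v : Fin 3 → ℝ, Real.sqrt (∑ i, v i ^ 2) ^ (α - 3) *
          (Real.exp (-(t * ∑ i, v i ^ 2)) * Real.cos (∑ i, k i * v i) -
            Real.exp (-(t * ∑ i, (v i + u i) ^ 2)) * Real.cos (∑ i, k i * (v i + u i)))) →
        ∀ y : Site 3, |(R : ℝ) ^ (-α) * (Ψ 0 - Ψ y) - c * D (fun i => (y i : ℝ) / R)| ≤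
          ε * min (∑ i, ((y i : ℝ) / R) ^ 2) 1 := by
  intro G α c t k hG0 hG1 hGe hα1 hα2 hc ht hT
  set φ : (Fin 3 → ℝ) → ℝ := fun v => Real.exp (-(t * ∑ i, v i ^ 2)) * Real.cos (∑ i, k i * v i)
    with hφdef
  have hφ : ∀ v, φ v = Real.exp (-(t * ∑ i, v i ^ 2)) * Real.cos (∑ i, k i * v i) := fun v => rfl
  obtain ⟨hφc, hφenv, hφe⟩ := kernSc_phi_props hφ
  -- (1) summability of the rescaled test function (Riemann lemma with `G = 1`, `s = 0`)
  have hsumm : ∀ R : ℕ, 1 ≤ R → Summable (fun z : Site 3 => φ (fun i => (z i : ℝ) / R)) := by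
    intro R hR
    have h := (kernSc_sum_as_integral (G := fun _ => (1 : ℝ)) (fun _ => zero_le_one) (fun _ => le_rfl)
      α ht zero_le_one hR hφc hφenv 0).1
    refine h.congr fun z => ?_
    simp only [Pi.zero_apply, add_zero, one_mul]
  refine ⟨fun R hR => hsumm R hR, fun ε hε => ?_⟩
  -- (2) constants of the test-function family and the two Riemann lemmas
  obtain ⟨Aq, hAq, henvq⟩ := kernSc_secondDiff_env ht k
  obtain ⟨Lq, hLq, hlipq⟩ := kernSc_secondDiff_lipschitz ht k
  obtain ⟨Lφ, hLφ, hlipφ⟩ := kernSc_phi_lipschitz ht k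
  obtain ⟨R₁, hR₁1, hRiem₁⟩ := stub_kernelScaling_auxRiemann G α c hG0 hG1 hα1 hα2 hc hT t 1 Lφ (ε / 2)
    ht zero_le_one hLφ.le (half_pos hε)
  obtain ⟨R₂, hR₂1, hRiem₂⟩ := stub_kernelScaling_auxRiemann G α c hG0 hG1 hα1 hα2 hc hT (t / 2) Aq Lq ε
    (half_pos ht) hAq.le hLq.le hε
  refine ⟨max R₁ R₂, fun R hR Ψ D hΨ hD y => ?_⟩
  have hRR₁ : R₁ ≤ R := (le_max_left _ _).trans hR
  have hRR₂ : R₂ ≤ R := (le_max_right _ _).trans hR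
  have hRnat : 1 ≤ R := hR₁1.trans hRR₁
  have hR1 : (1 : ℝ) ≤ R := by exact_mod_cast hRnat
  have hRpos : (0 : ℝ) < R := one_pos.trans_le hR1
  -- notation: the rescaled test function, the shift `u = y/R`
  set φR : Site 3 → ℝ := fun z => φ (fun i => (z i : ℝ) / R) with hφR
  set u : Fin 3 → ℝ := fun i => (y i : ℝ) / R with hu
  have hφRe : ∀ x, φR (-x) = φR x := fun x => by
    simp only [hφR]
    rw [kernSc_cast_neg_div, hφe]
  have hΨ0 : Ψ 0 = ∑' x : Site 3, G x * φR x := by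
    rw [hΨ 0]
    exact tsum_congr fun z => by rw [sub_zero, mul_comm]
  have hΨy : Ψ y = ∑' x : Site 3, G x * φR (x + y) := by
    rw [hΨ y]
    exact kernSc_tsum_shift φR G y
  have hsφR : Summable φR := hsumm R hRnat
  have hs0 : Summable (fun x : Site 3 => G x * φR x) := by
    simpa using kernSc_summable_shift hsφR hG0 hG1 0
  have hsp : Summable (fun x : Site 3 => G x * φR (x + y)) := kernSc_summable_shift hsφR hG0 hG1 y
  have hsm : Summable (fun x : Site 3 => G x * φR (x - y)) := by
    simpa [sub_eq_add_neg] using kernSc_summable_shift hsφR hG0 hG1 (-y)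
  -- the lattice sums of the Riemann lemma, at the shifts `0` and `u`
  have hsumφ0 : ∑' x : Site 3, G x * φ (fun i => (x i : ℝ) / R + (0 : Fin 3 → ℝ) i) =
      ∑' x : Site 3, G x * φR x := tsum_congr fun x => by
    simp only [Pi.zero_apply, add_zero]
    rfl
  have hsumφu : ∑' x : Site 3, G x * φ (fun i => (x i : ℝ) / R + u i) =
      ∑' x : Site 3, G x * φR (x + y) := tsum_congr fun x => by
    simp only [hφR, hu]
    rw [kernSc_cast_add_div]
    rfl
  -- the integrals
  have hDu : D u = ∫ v : Fin 3 → ℝ, √(∑ i, v i ^ 2) ^ (α - 3) * (φ v - φ (v + u)) := by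
    rw [hD u]
    rfl
  have hlip' : ∀ w w' : Fin 3 → ℝ, ‖w' - w‖ ≤ 1 / (R : ℝ) → |φ w' - φ w| ≤ Lφ / (R : ℝ) :=
    fun w w' hww => by
      have h := hlipφ φ hφ (1 / R) (by positivity) (by rw [div_le_one hRpos]; exact hR1) w w' hww
      simpa only [mul_one_div] using h
  by_cases hy : y = 0
  · -- `u = 0`: both sides vanish
    subst hy
    have hu0 : u = 0 := by
      funext i
      simp [hu]
    have hD0 : D u = 0 := by
      rw [hDu, hu0]
      simp
    rw [sub_self, mul_zero, hD0, mul_zero, sub_self, abs_zero]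
    positivity
  -- `u ≠ 0`
  have hSu0 : 0 < ∑ i, u i ^ 2 := by
    obtain ⟨j, hj⟩ : ∃ j, y j ≠ 0 := by
      by_contra h
      push Not at h
      exact hy (funext h)
    have h1 : 0 < u j ^ 2 := by
      have : u j ≠ 0 := by
        simp only [hu]
        exact div_ne_zero (by exact_mod_cast hj) hRpos.ne'
      positivity
    exact lt_of_lt_of_le h1 (Finset.single_le_sum (f := fun i => u i ^ 2) (fun i _ => sq_nonneg _)
      (Finset.mem_univ j))
  by_cases hSu1 : ∑ i, u i ^ 2 ≤ 1
  · -- small shifts: symmetrise and use the second-difference family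
    rw [min_eq_left hSu1]
    set q : (Fin 3 → ℝ) → ℝ := fun w => 2 * φ w - φ (w + u) - φ (w - u) with hq
    set hh : (Fin 3 → ℝ) → ℝ := fun w => q w / ∑ i, u i ^ 2 with hhh
    have hhc : Continuous hh := by
      simp only [hhh, hq]
      fun_prop
    have hhenv : ∀ w, |hh w| ≤ Aq * Real.exp (-(t / 2 * ∑ i, w i ^ 2)) := fun w => by
      simp only [hhh, hq]
      rw [abs_div, abs_of_pos hSu0, div_le_iff₀ hSu0]
      calc |2 * φ w - φ (w + u) - φ (w - u)| ≤ Aq * (∑ i, u i ^ 2) * Real.exp (-(t / 2 * ∑ i, w i ^ 2)) :=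
            henvq φ hφ w u hSu1
        _ = Aq * Real.exp (-(t / 2 * ∑ i, w i ^ 2)) * ∑ i, u i ^ 2 := by ring
    have hhlip : ∀ w w' : Fin 3 → ℝ, ‖w' - w‖ ≤ 1 / (R : ℝ) → |hh w' - hh w| ≤ Lq / (R : ℝ) := by
      intro w w' hww
      simp only [hhh, hq]
      rw [← sub_div, abs_div, abs_of_pos hSu0, div_le_iff₀ hSu0]
      calc |2 * φ w' - φ (w' + u) - φ (w' - u) - (2 * φ w - φ (w + u) - φ (w - u))|
          ≤ Lq * (1 / R) * ∑ i, u i ^ 2 :=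
            hlipq φ hφ (1 / R) (by positivity) (by rw [div_le_one hRpos]; exact hR1) w w' u hSu1 hww
        _ = Lq / R * ∑ i, u i ^ 2 := by ring
    obtain ⟨-, hintq, hbd⟩ := hRiem₂ R hRR₂ hh hhc hhenv hhlip 0
    -- identify the lattice sum
    have hS : ∑' x : Site 3, G x * hh (fun i => (x i : ℝ) / R + (0 : Fin 3 → ℝ) i) =
        (∑' x : Site 3, G x * (2 * φR x - φR (x + y) - φR (x - y))) / ∑ i, u i ^ 2 := by
      rw [← tsum_div_const]
      refine tsum_congr fun x => ?_
      simp only [hhh, hq, hφR, hu, Pi.zero_apply, add_zero]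
      rw [kernSc_cast_add_div, kernSc_cast_sub_div]
      ring
    have hΨsym : Ψ 0 - Ψ y = (1 / 2) * ∑' x : Site 3, G x * (2 * φR x - φR (x + y) - φR (x - y)) := by
      have h1 : Ψ y = ∑' x : Site 3, G x * φR (x - y) := by
        rw [hΨy]
        exact kernSc_tsum_reflect hφRe hGe y
      have h2 : ∑' x : Site 3, G x * (2 * φR x - φR (x + y) - φR (x - y)) =
          2 * (∑' x : Site 3, G x * φR x) - (∑' x : Site 3, G x * φR (x + y)) -
            ∑' x : Site 3, G x * φR (x - y) := by
        rw [← tsum_mul_left, ← (hs0.mul_left 2).tsum_sub hsp, ← ((hs0.mul_left 2).sub hsp).tsum_sub hsm]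
        exact tsum_congr fun x => by ring
      rw [h2, ← hΨ0, ← hΨy, ← h1]
      ring
    -- identify the integral
    have hI : ∫ v : Fin 3 → ℝ, √(∑ i, v i ^ 2) ^ (α - 3) * hh (v + 0) =
        (∫ v : Fin 3 → ℝ, √(∑ i, v i ^ 2) ^ (α - 3) * q v) / ∑ i, u i ^ 2 := by
      rw [← integral_div]
      refine integral_congr_ae (ae_of_all _ fun v => ?_)
      simp only [hhh, add_zero]
      ring
    have hintp : Integrable (fun v : Fin 3 → ℝ => √(∑ i, v i ^ 2) ^ (α - 3) * (φ v - φ (v + u))) := by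
      have h1 := (hRiem₁ R hRR₁ φ hφc hφenv hlip' 0).2.1
      have h2 := (hRiem₁ R hRR₁ φ hφc hφenv hlip' u).2.1
      simp only [add_zero] at h1
      refine (h1.sub h2).congr (ae_of_all _ fun v => ?_)
      simp only [Pi.sub_apply]
      ring
    have hintm : Integrable (fun v : Fin 3 → ℝ => √(∑ i, v i ^ 2) ^ (α - 3) * (φ v - φ (v - u))) := by
      have h := hintp.comp_neg
      refine h.congr (ae_of_all _ fun v => ?_)
      simp only [Pi.neg_apply, neg_sq, hφe]
      rw [show -v + u = -(v - u) by abel, hφe]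
    have hDsym : D u = (1 / 2) * ∫ v : Fin 3 → ℝ, √(∑ i, v i ^ 2) ^ (α - 3) * q v := by
      have h1 : D u = ∫ v : Fin 3 → ℝ, √(∑ i, v i ^ 2) ^ (α - 3) * (φ v - φ (v - u)) := by
        rw [hDu]
        exact kernSc_integral_reflect hφe (α - 3) u
      have h2 : ∫ v : Fin 3 → ℝ, √(∑ i, v i ^ 2) ^ (α - 3) * q v =
          (∫ v : Fin 3 → ℝ, √(∑ i, v i ^ 2) ^ (α - 3) * (φ v - φ (v + u))) +
            ∫ v : Fin 3 → ℝ, √(∑ i, v i ^ 2) ^ (α - 3) * (φ v - φ (v - u)) := by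
        rw [← integral_add hintp hintm]
        refine integral_congr_ae (ae_of_all _ fun v => ?_)
        simp only [hq]
        ring
      rw [h2, ← hDu, ← h1]
      ring
    -- conclude
    have hkey : (R : ℝ) ^ (-α) * (Ψ 0 - Ψ y) - c * D u =
        (1 / 2) * (∑ i, u i ^ 2) *
          ((R : ℝ) ^ (-α) * ∑' x : Site 3, G x * hh (fun i => (x i : ℝ) / R + (0 : Fin 3 → ℝ) i) -
            c * ∫ v : Fin 3 → ℝ, √(∑ i, v i ^ 2) ^ (α - 3) * hh (v + 0)) := by
      rw [hS, hI, hΨsym, hDsym]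
      field_simp
    rw [hkey, abs_mul, abs_of_pos (by positivity : (0 : ℝ) < 1 / 2 * ∑ i, u i ^ 2)]
    calc 1 / 2 * (∑ i, u i ^ 2) * |(R : ℝ) ^ (-α) * ∑' x : Site 3, G x * hh (fun i => (x i : ℝ) / R + (0 : Fin 3 → ℝ) i) -
          c * ∫ v : Fin 3 → ℝ, √(∑ i, v i ^ 2) ^ (α - 3) * hh (v + 0)|
        ≤ 1 / 2 * (∑ i, u i ^ 2) * ε := mul_le_mul_of_nonneg_left hbd (by positivity)
      _ ≤ ε * ∑ i, u i ^ 2 := by nlinarith [hSu0, hε]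
  · -- large shifts: the Riemann lemma at the shifts `0` and `u`
    push Not at hSu1
    rw [min_eq_right hSu1.le, mul_one]
    obtain ⟨-, hint0, hbd0⟩ := hRiem₁ R hRR₁ φ hφc hφenv hlip' 0
    obtain ⟨-, hintu, hbdu⟩ := hRiem₁ R hRR₁ φ hφc hφenv hlip' u
    simp only [add_zero] at hint0 hbd0
    rw [hsumφ0] at hbd0
    rw [hsumφu] at hbdu
    have hkey : (R : ℝ) ^ (-α) * (Ψ 0 - Ψ y) - c * D u =
        ((R : ℝ) ^ (-α) * (∑' x : Site 3, G x * φR x) - c * ∫ v : Fin 3 → ℝ, √(∑ i, v i ^ 2) ^ (α - 3) * φ v) -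
          ((R : ℝ) ^ (-α) * (∑' x : Site 3, G x * φR (x + y)) -
            c * ∫ v : Fin 3 → ℝ, √(∑ i, v i ^ 2) ^ (α - 3) * φ (v + u)) := by
      rw [hΨ0, hΨy, hDu]
      have h1 : ∫ v : Fin 3 → ℝ, √(∑ i, v i ^ 2) ^ (α - 3) * (φ v - φ (v + u)) =
          (∫ v : Fin 3 → ℝ, √(∑ i, v i ^ 2) ^ (α - 3) * φ v) -
            ∫ v : Fin 3 → ℝ, √(∑ i, v i ^ 2) ^ (α - 3) * φ (v + u) := by
        rw [← integral_sub hint0 hintu]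
        refine integral_congr_ae (ae_of_all _ fun v => ?_)
        ring
      rw [h1]
      ring
    rw [hkey]
    calc _ ≤ |(R : ℝ) ^ (-α) * (∑' x : Site 3, G x * φR x) - c * ∫ v : Fin 3 → ℝ, √(∑ i, v i ^ 2) ^ (α - 3) * φ v| +
          |(R : ℝ) ^ (-α) * (∑' x : Site 3, G x * φR (x + y)) -
            c * ∫ v : Fin 3 → ℝ, √(∑ i, v i ^ 2) ^ (α - 3) * φ (v + u)| := abs_sub _ _
      _ ≤ ε / 2 + ε / 2 := add_le_add hbd0 hbdu
      _ = ε := by ring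

end Summit.CriticalPhenomena.Ising3DConformalLimit.Cruxes.DirectCorrelationStableTail.DiffusiveBranchIsNonsaturation

end
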